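import Literature.AlgebraicGeometry.ModuliOfSheaves.K3SheafModuli
import Literature.AlgebraicGeometry.Hyperkaehler.KummerTypeDominatedByWeilFourfoldPowers
import Literature.AlgebraicGeometry.Hyperkaehler.GeneralizedKummerVarietyHodgeConjecture
import Literature.AlgebraicGeometry.Hyperkaehler.BirationalIrreducibleSymplecticCohomology
import Literature.AlgebraicGeometry.Hyperkaehler.IrreducibleSymplecticOfDeformationType
import Literature.AlgebraicGeometry.HodgeTheory.WeilTypeGeneralMemberPowersHodgeConjecture
import Literature.AlgebraicGeometry.HodgeTheory.DominatedByPowersHodgeConjecture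
import Literature.AlgebraicGeometry.HodgeTheory.MotivatedClasses
import Literature.AlgebraicGeometry.Motives.FamiliesVHS
import Literature.AlgebraicGeometry.Motives.AbelianVarietyCohomologyExteriorH1
import HarnessLib

/-!
# Moduli spaces of stable sheaves on an abelian surface, their Kummer fibres `K_H(v)`, and "the moduli space is motivated by the surface" (Bülles 2020, Thm. 0.1) — DEFINITIONS + one NAMED FACT + kernel

Layer `Literature/AlgebraicGeometry/ModuliOfSheaves`.  Typed for the cross-ladder literature-typing layer
(D-0088(4), tranche LT-H4 "open-question harvest", seat `hodge-lit-oqh-2`; ladder HodgeAV rung H3 = the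
Hodge conjecture for projective `Kumⁿ`-type varieties).  The OPEN QUESTION the recent authors name — "the
Kummer moduli spaces of sheaves `K_H(v)` are motivated by the abelian surface `A`" (Floccari 2023 §1;
Floccari–Fu–Zhang 2021 Rem. 3.5, 4.8) — is typed on the summit side (`Summits/HodgeConjecture/HodgeConjecture/
Theorems/OpenQuestionsKummerModuliSpaces.lean`); this file supplies its CARRIERS, the KNOWN half as a named
fact (Bülles: `M_H(v)` itself IS motivated by the surface), and the kernel consequences the tree can draw.
HONEST FRAMING: typed ≠ proved ≠ endorsed.  Nothing here asserts the Hodge conjecture for any `Kumⁿ`-type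
variety, any `K_H(v)`, any K3 surface or any `K3^{[n]}`-type variety; the one new named fact is a REFEREED
theorem in print; every `theorem` below is proved in the kernel modulo the named facts it takes as hypotheses.

## Sources (read at source this session; locators = files of the materialised texts)

* [Yos01] K. Yoshioka, *Moduli spaces of stable sheaves on abelian surfaces*, Math. Ann. 321 (2001)
  817–884 [`Yoshioka2001AbelianSurfaces`; REFEREED; corpus:paper:arxiv-math_0009001; theorem numbers in
  this file are the journal's §0 numbering — the arXiv text prints Thm. 0.1 ∕ 0.2 and Def. 0.1 as
  Thm. 1.1 ∕ 1.2 and Def. 1.1 (referee F-4)].  §0 p0002:L30–L41: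
  "Mukai proved that `M_H(v)` is smooth of dimension `⟨v²⟩ + 2` […] If `H` is a general element of the
  ample cone […] and `v` is primitive, then `M̄_H(v) = M_H(v)`, in particular `M_H(v)` is a projective
  scheme."  **Thm. 0.1** (p0002:L81–L92): "Let `X` be an abelian surface. Let `v` be a primitive Mukai
  vector such that `v > 0`, `c₁(v) ∈ NS(X)` and `⟨v²⟩ ≥ 2`. Then for an ample divisor `H` such that
  `M̄_H(v) = M_H(v)`, (1) `𝔞_v : M_H(v) → X × X̂` is the albanese map. (2) `M_H(v)` is deformation
  equivalent to `X̂ × Hilb_X^{⟨v²⟩/2}`."  p0002:L101–L102: "Let `K_H(v)` be a fiber of `𝔞_v`. Then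
  `dim K_H(v) = ⟨v²⟩ - 2`."  **Thm. 0.2 (1)** (p0002:L108–L121): "`⟨v²⟩ ≥ 6`. (1) For a general ample
  line bundle `H`, `K_H(v)` is deformation equivalent to a generalized Kummer variety `K_{⟨v²⟩/2-1}`
  constructed by Beauville. In particular, `K_H(v)` is an irreducible symplectic manifold."
* [Bül20] T.-H. Bülles, *Motives of moduli spaces on K3 surfaces and of special cubic fourfolds*,
  Manuscripta Math. 161 (2020) 109–124 [`Bulles2020`; REFEREED; corpus:paper:arxiv-1806.08284].
  **Thm. 0.1** (arXiv "Theorem 1", p0003:L7–L13), verbatim: "Let `S` be a complex projective K3 surface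
  or an abelian surface and `α ∈ Br(S)`. Assume that `M` is one of the following: • a smooth projective
  moduli space of Gieseker stable `α`-twisted sheaves or • a smooth projective moduli space of `σ`-stable
  objects in `Dᵇ(S,α)`, where `σ` is a generic stability condition. Then the Chow motive `𝔥(M)` of `M`
  is a direct summand of a motive `⊕ 𝔥(S^{k_i})(n_i)` for some `1 ≤ k_i ≤ dim M`, `n_i ∈ ℤ`."  Proof
  (§1.1, p0006:L5–L50): quasi-universal sheaf on `M × S`, Markman's theorem "the class of the diagonal
  `[Δ_M]` lies in the ideal `I ⊂ CH^*(M × M)_ℚ` generated by correspondences factoring through powers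
  `S^k`", whence `[Δ_M] = Σ δ_i ∘ γ_i` with `γ_i ∈ CH(M × S^{k_i})`, `δ_i ∈ CH(S^{k_i} × M)`.
* [Flo23] S. Floccari, *On the motive of O'Grady's six dimensional hyper-Kähler varieties*, Épijournal
  Géom. Algébrique 7 (2023) Art. 4 [`Floccari2023OG6Motive`; REFEREED; corpus:paper:arxiv-2203.16257],
  §1 p0002:L16–L18: "By [Yos01], the Albanese map `M_v(A,H) → A × Â` is an isotrivial fibration; we
  denote by `K_v(A,H)` the fibre of this morphism. When the effective Mukai vector `w` is primitive, the
  moduli space `M_w(A,H)` is a smooth and projective variety, and `K_w(A,H)` is a hyper-Kähler variety of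
  generalized Kummer type"; p0002:L33–L37: "Each of the varieties introduced above is expected to be
  motivated by the surface; this means that the rational Chow motive of such a variety should belong to
  the tensor subcategory generated by the motive of `A`. For the smooth and projective moduli spaces
  `M_w(A,H)` associated to a primitive Mukai vector `w`, this has been confirmed by Bülles [Bue18]. […]
  **For the hyper-Kähler varieties `K_w(A,H)` and `K̃_v(A,H)`, however, the question remained open**; in
  this note we deal with the OG6-type varieties `K̃_v(A,H)`."
* [FFZ21] S. Floccari, L. Fu, Z. Zhang, Commun. Contemp. Math. 23 (2021) 2050034
  [`FloccariFuZhang2021OG10Motive`; REFEREED; corpus:paper:arxiv-1911.06572], Remark 3.5 "Challenge for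
  Kummer moduli spaces" (p0014:L1–L2): "`ℳ^st` is isotrivially fibered over `S × Ŝ` (which is the Albanese
  fibration when `ℳ^st` is projective). We usually denote by `𝒦^st` its fiber. The analogue of [Markman's]
  Theorem seems to be unknown for `𝒦^st`"; Remark 4.8 "Motives of Kummer moduli spaces" (p0017:L20):
  "Except for some special cases like generalized Kummer varieties (see [FTV19]), the analog[ues …] are
  unknown for those fibers in general. The missing ingredient is the analog[ue] of Markman's Theorem."
* Huybrechts–Lehn [`HuybrechtsLehn1997`] Def. 1.2.4, 4.6.1 (as rendered in `ModuliOfSheaves/K3SheafModuli`);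
  Arapura 2006 [`Arapura2006`] Lemma 4.2 / 1.1 (the tree's record
  `HodgeTheory.Arapura2006_hodgeClasses_algebraic_of_isDominatedByPowers` and `HodgeTheory.IsDominatedByPowers`).

## Rendering (tree carriers) and faithfulness

* "moduli space `M_H(v)` of `H`-stable sheaves with Mukai vector `v` on the abelian surface `A`, all
  `H`-semistable sheaves stable, with its universal family": `AbelianSurfaceSheafModuli C A p H v M 𝓔` —
  the tree's fine-moduli predicate `IsUniversalFamily A.X P M 𝓔` (HL Def. 4.6.1) for the fibre predicate
  `P F = "F is Gieseker H-stable torsion-free of some rank r (IsGiesekerStable C p H F r) and ch(F) = v"`,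
  EXACTLY as the tree's `K3SheafModuliUniversalFamily` does for K3 surfaces, with three additions: the
  Chern character theory `C` is coherent-additive on `A` (`ChernCharacterBetti.CoherentAdditiveOn`), the
  reference class `p ∈ H⁴(A(ℂ); ℂ)` is an INTEGRAL GENERATOR (the point class, up to the universal sign),
  `H` is a polarisation class (`HodgeTheory.IsPolarizationClass 2 A.X H`: rational, algebraic, hard
  Lefschetz), and Yoshioka's hypothesis "`M̄_H(v) = M_H(v)`" is the clause "every `H`-semistable `F` with
  `ch(F) = v` is `H`-stable".  On an abelian surface `td(A) = 1`, so the Mukai vector IS the Chern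
  character: the numerical datum is `v = (chᵢ)ᵢ`, `vᵢ ∈ H^{2i}(A(ℂ); ℂ)`.  As in `K3SheafModuli` (module
  docstring items 1–7) the predicate is read with `C` = the Chern character; `IsPolarizationClass` is a
  priori wider than "class of an ample divisor" (a non-degenerate non-ample rational class on an abelian
  surface also has the hard Lefschetz property) — see "scope" below.  Only TORSION-FREE sheaves (positive
  rank) are covered by the tree's Gieseker predicate: Yoshioka's rank-`0` positive vectors are left out
  (WEAKER, never stronger).
* "the Kummer moduli space `K_H(v)`, a fibre of the Albanese map `𝔞_v : M_H(v) → A × Â`, of dimension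
  `⟨v²⟩ - 2 = 2n`, of `Kumⁿ`-type": `IsKummerSheafModuliSpace n A K` — there are `(C, p, H, v, M, 𝓔)` as
  above with `M` smooth projective of dimension `2n + 4` (`= ⟨v²⟩ + 2`), an abelian variety `T`, a
  morphism `f : M ⟶ T.X` and a complex point `t ∈ T(ℂ)` with `K ≅ M ×_T {t}` (`Motives.fiberOver f t`),
  AND `K` is smooth projective of dimension `2n` and of `Kumⁿ`-type.  The tree has no Albanese MAP for a
  higher-dimensional variety, but none is needed: every morphism `f` from `M` to an abelian variety
  factors through the Albanese map `alb` of `M` followed by a homomorphism and a translation, so a fibre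
  `K = f⁻¹(t)` is a union of Albanese fibres; `K` being smooth, connected and SIMPLY CONNECTED (it is of
  `Kumⁿ`-type), `alb|_K` is constant, so `K ⊂ alb⁻¹(c) ⊂ f⁻¹(t) = K` and `K` IS an Albanese fibre
  (equality of schemes because `K` is reduced and the two have the same support).  Hence, classically,
  every `K` with `IsKummerSheafModuliSpace n A K` is one of Yoshioka's `K_H(v)` with `v` primitive (a
  non-primitive `v = m v₀` admits strictly semistable sheaves, excluded by the `M̄ = M` clause), `v > 0`,
  `⟨v²⟩ = 2n + 2 ≥ 6` for `n ≥ 2` — and conversely Yoshioka's `K_H(v)` for `H` general AND `M_H(v)` FINE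
  (a universal family is part of `AbelianSurfaceSheafModuli`; e.g. `⟨v, v'⟩ = 1` for some Mukai vector
  `v'`, Huybrechts–Lehn Thm. 4.6.5 ∕ Cor. 4.6.7; always for `v = (1, 0, -n-1)`) satisfy it (non-vacuity,
  [Yos01] Thm. 0.1–0.2, not asserted here).  So the typed class is the FINE sub-class of the printed
  Kummer moduli spaces — fewer varieties, the WEAKER direction for every `∀`-statement over it (referee
  `hodge-lit-oqh-1` g6, finding F-1).  Scope: `H` a polarisation class in the tree's
  sense ⊇ ample classes; stability only depends on the ray of `H`, and for the non-ample members of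
  `IsPolarizationClass` no smooth projective fine moduli space with `Kumⁿ`-type Albanese fibres other than
  the rank-one ones (`Pic × Hilb`, fibres Beauville's `Kₙ(A)`) is known to the typist — recorded, not used.
* "`𝔥(M)` is a direct summand of `⊕ 𝔥(S^{k_i})(n_i)`" ⟹ its COHOMOLOGICAL SHADOW on the real carriers:
  `H^*(M(ℂ); ℂ)` is spanned by images of algebraic correspondences from the powers `S^k`, i.e. the tree's
  `HodgeTheory.IsDominatedByPowers (dim M) M 2 S` (Arapura's "`M` is motivated by `S`", Lemma 1.1 form) —
  WEAKER than the Chow statement, exactly the form the tree's Arapura record consumes.  Typed for the two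
  surfaces of the printed sentence: K3 (on the tree's `K3SheafModuliUniversalFamily`, read as its
  docstring prescribes: `p` the point class, `H` the polarisation) and abelian (on `AbelianSurfaceSheafModuli`);
  untwisted sheaves only (`α = 1`), fine moduli spaces only (print: any smooth projective moduli space of
  stable sheaves; a quasi-universal sheaf suffices there) — WEAKER than print, never stronger.
  -- TODO(general form): twisted sheaves `α ∈ Br(S)`; `σ`-stable objects; non-fine moduli spaces.

## What is NOT here (and why)

The open question itself (summit side, conjecture-tagged); Yoshioka's Thms. 0.1–0.2 as facts (the
genericity hypothesis "`H` general in the ample cone" has no carrier; the `Kumⁿ`-type conclusion is a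
HYPOTHESIS of `IsKummerSheafModuliSpace` instead); the Albanese map; Markman's diagonal theorem; the
identification of Beauville's `Kₙ(A)` (`Hyperkaehler.IsGeneralizedKummerVarietyOf`, Hodge conjecture known
by `Hyperkaehler.Xu2018_hodgeClasses_algebraic_generalizedKummerVariety`) with `K_H(1, 0, -n-1)`.

## Content and D-0026 accounting

* DEFINITIONS `AbelianSurfaceSheafModuli`, `IsKummerSheafModuliSpace` (+ projection lemmas); ONE NAMED FACT
  `Bulles2020_sheafModuli_isDominatedByPowers_surface` (+1; REFEREED theorem in print); KERNEL (proved):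
  `HodgeTheory.hodgeConjectureFor_of_isDominatedByPowers_abelianSurface` (Arapura's record + the tree's
  THEOREM `hodgeConjectureFor_powSucc_of_surface`); `Bulles2020_….hodgeConjectureFor_abelianSurface`
  (**the Hodge conjecture for every smooth projective fine moduli space `M_H(v)` of stable sheaves on an
  abelian surface and for all its powers**, modulo the two records); `….hodgeConjectureFor_K3_of_powers`
  (`HC(S^k)` for all `k` ⟹ `HC(M_H(v))` and powers); `….hodgeConjectureFor_kummerK3` (Kummer surfaces,
  modulo Xu's record); `IsKummerSheafModuliSpace.hodgeConjectureFor_of_isDominatedByPowers` (THE REDUCTION: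
  the cohomological shadow of the open question implies the Hodge conjecture for `K_H(v)` and its powers).
-/

noncomputable section

open CategoryTheory MonoidalCategory

namespace Literature.AlgebraicGeometry.HodgeTheory

open Motives (SchemeOver AbelianVariety IsSmoothProjective)

/-! ### Kernel: domination by the powers of an abelian surface gives the Hodge conjecture -/

/-- **Whatever is dominated by the powers of a complex abelian SURFACE satisfies the Hodge conjecture,
together with all its cartesian powers** — Arapura 2006 Lemma 4.2 (the tree's record, hypothesis `hA42`)
fed with the tree's THEOREM `hodgeConjectureFor_powSucc_of_surface` (Moonen–Zarhin 1999 / Ramón Marí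
2008: every power of every abelian surface), transported from `A.powSucc k` to `A.X.pow (k+1)` by
`hodgeConjectureFor_pow_of_forall_powSucc`.  This is the mechanism of Xu 2018 Thm. 1.3 (generalized
Kummer varieties) and of the expected "Kummer moduli spaces are motivated by `A`".
[cite: Arapura2006, Lemma 4.2 and Lemma 1.1] [cite: MoonenZarhin1999LowDim, §2 p. 715] [cite: Xu2018Kummer, proof of Thm. 3.3] -/
theorem hodgeConjectureFor_of_isDominatedByPowers_abelianSurface
    (hA42 : Arapura2006_hodgeClasses_algebraic_of_isDominatedByPowers) (A : AbelianVariety ℂ)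
    (hA : A.dim = 2) {N : ℕ} {Y : SchemeOver ℂ} (hY : IsSmoothProjective N Y)
    (hdom : IsDominatedByPowers N Y 2 A.X) :
    HodgeConjectureFor N Y ∧ ∀ m : ℕ, HodgeConjectureFor ((m + 1) * N) (Y.pow (m + 1)) := by
  have hAX : IsSmoothProjective 2 A.X := Motives.isSmoothProjective_of_dim_eq' hA
  have hpow : ∀ m : ℕ, HodgeConjectureFor ((m + 1) * 2) (A.X.pow (m + 1)) := fun m ↦ by
    have h := hodgeConjectureFor_pow_of_forall_powSucc A
      (fun k ↦ hodgeConjectureFor_powSucc_of_surface A hA k) m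
    rwa [hA] at h
  exact hA42 hAX hY hdom hpow

end Literature.AlgebraicGeometry.HodgeTheory

namespace Literature.AlgebraicGeometry.ModuliOfSheaves

open HodgeTheory
open Motives (SchemeOver AbelianVariety IsSmoothProjective ComplexPoints fiberOver)

/-! ### The fine moduli space `M_H(v)` of stable sheaves on an abelian surface -/

section AbelianSurface

variable (C : ChernCharacterBetti)

/-- **`(M, 𝓔)` is the fine moduli space `M_H(v)` of `H`-stable sheaves with Chern character (= Mukai
vector, `td(A) = 1`) `v` on the complex abelian SURFACE `A`, in Yoshioka's situation `M̄_H(v) = M_H(v)`**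
([Yos01] §0: "`M_H(v)` be the moduli space of stable sheaves `E` of `v(E) = v`", "for an ample divisor
`H` such that `M̄_H(v) = M_H(v)`"; HL Def. 4.6.1 for "fine"): `A.dim = 2`; `C` is coherent-additive on
`A`; `p ∈ H⁴(A(ℂ); ℂ)` is an integral generator (the point class up to sign); `H ∈ H²(A(ℂ); ℂ)` is a
polarisation class; every Gieseker `H`-semistable torsion-free `F` with `ch(F) = v` is `H`-stable; and
`𝓔` on `A × M` is a UNIVERSAL family for "Gieseker `H`-stable torsion-free of some rank with `ch = v`"
(`IsUniversalFamily`).  The abelian-surface twin of `K3SheafModuliUniversalFamily`.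
[cite: Yoshioka2001AbelianSurfaces, §0 (arXiv p. 2: M_H(v), M̄_H(v) = M_H(v)) and Thm. 0.1]
[cite: HuybrechtsLehn1997, Def. 1.2.4 and Def. 4.6.1] -/
def AbelianSurfaceSheafModuli (A : AbelianVariety ℂ) (p : complexBetti A.X (2 * 2))
    (H : complexBetti A.X (2 * 1)) (v : (i : ℕ) → complexBetti A.X (2 * i)) (M : SchemeOver ℂ)
    (E : (A.X ⊗ M).left.Modules) : Prop :=
  A.dim = 2 ∧ C.CoherentAdditiveOn A.X ∧
    (IsIntegralClass p ∧ ∀ q : complexBetti A.X (2 * 2), IsIntegralClass q → ∃ m : ℤ, q = m • p) ∧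
    IsPolarizationClass 2 A.X H ∧
    (∀ (F : A.X.left.Modules) (r : ℕ), IsGiesekerSemistable C p H F r → (∀ i, C.ch A.X F i = v i) →
      IsGiesekerStable C p H F r) ∧
    IsUniversalFamily A.X (fun F ↦ (∃ r : ℕ, IsGiesekerStable C p H F r) ∧ ∀ i, C.ch A.X F i = v i) M E

namespace AbelianSurfaceSheafModuli

variable {C} {A : AbelianVariety ℂ} {p : complexBetti A.X (2 * 2)} {H : complexBetti A.X (2 * 1)}
  {v : (i : ℕ) → complexBetti A.X (2 * i)} {M : SchemeOver ℂ} {E : (A.X ⊗ M).left.Modules}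

/-- The base is an abelian surface. [cite: Yoshioka2001AbelianSurfaces, §0] -/
theorem dim_eq (h : AbelianSurfaceSheafModuli C A p H v M E) : A.dim = 2 := h.1

/-- The base surface is smooth projective of dimension `2`. [cite: Yoshioka2001AbelianSurfaces, §0] -/
theorem isSmoothProjective_surface (h : AbelianSurfaceSheafModuli C A p H v M E) :
    IsSmoothProjective 2 A.X :=
  Motives.isSmoothProjective_of_dim_eq' h.1

/-- `H` is a polarisation class. [cite: Yoshioka2001AbelianSurfaces, §0] -/
theorem isPolarizationClass (h : AbelianSurfaceSheafModuli C A p H v M E) : IsPolarizationClass 2 A.X H :=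
  h.2.2.2.1

/-- Yoshioka's clause `M̄_H(v) = M_H(v)`: semistable sheaves of class `v` are stable.
[cite: Yoshioka2001AbelianSurfaces, Thm. 0.1 (hypothesis)] -/
theorem stable_of_semistable (h : AbelianSurfaceSheafModuli C A p H v M E) {F : A.X.left.Modules} {r : ℕ}
    (hF : IsGiesekerSemistable C p H F r) (hv : ∀ i, C.ch A.X F i = v i) : IsGiesekerStable C p H F r :=
  h.2.2.2.2.1 F r hF hv

/-- `𝓔` is a universal family of `H`-stable sheaves with `ch = v` on `A × M` (`M` is a FINE moduli space).
[cite: HuybrechtsLehn1997, Def. 4.6.1] -/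
theorem isUniversalFamily (h : AbelianSurfaceSheafModuli C A p H v M E) :
    IsUniversalFamily A.X (fun F ↦ (∃ r : ℕ, IsGiesekerStable C p H F r) ∧ ∀ i, C.ch A.X F i = v i) M E :=
  h.2.2.2.2.2

/-- Every fibre `𝓔_t` is an `H`-stable sheaf with `ch = v`. [cite: HuybrechtsLehn1997, Def. 4.6.1 and §4.1] -/
theorem fibre_stable (h : AbelianSurfaceSheafModuli C A p H v M E) (t : ComplexPoints M) :
    (∃ r : ℕ, IsGiesekerStable C p H (familyFibre E t) r) ∧ ∀ i, C.ch A.X (familyFibre E t) i = v i :=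
  h.isUniversalFamily.isFamilyOf.2.2 t

end AbelianSurfaceSheafModuli

/-! ### The Kummer moduli spaces `K_H(v)` (Albanese fibres) -/

/-- **`K` is a KUMMER MODULI SPACE OF SHEAVES `K_H(v)` on the abelian surface `A`, of dimension `2n` and
of `Kumⁿ`-type** ([Yos01] Thm. 0.1–0.2: "Let `K_H(v)` be a fiber of [the Albanese map] `𝔞_v`. Then
`dim K_H(v) = ⟨v²⟩ - 2` […] `K_H(v)` is deformation equivalent to a generalized Kummer variety
`K_{⟨v²⟩/2-1}`"; [FFZ21] "Kummer moduli spaces of sheaves"; [Flo23] "`K_w(A,H)` […] a hyper-Kähler variety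
of generalized Kummer type"): there are a fine moduli space `(M, 𝓔) = M_H(v)` on `A` as in
`AbelianSurfaceSheafModuli`, smooth projective of dimension `2n + 4 = ⟨v²⟩ + 2`, an abelian variety `T`,
a morphism `f : M ⟶ T` and `t ∈ T(ℂ)` with `K ≅ f⁻¹(t)` (`Motives.fiberOver`), and `K` is smooth projective
of dimension `2n` and of `Kumⁿ`-type.  Module docstring: such a `K` is a fibre of the Albanese map of
`M` (any map to an abelian variety factors through it; `K` is simply connected), i.e. Yoshioka's `K_H(v)`,
`v` primitive, `⟨v²⟩ = 2n + 2`. [cite: Yoshioka2001AbelianSurfaces, Thm. 0.1 (1) and Thm. 0.2 (1) (arXiv p. 2)]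
[cite: FloccariFuZhang2021OG10Motive, Remark 3.5 and Remark 4.8] [cite: Floccari2023OG6Motive, §1 (arXiv p. 2)] -/
def IsKummerSheafModuliSpace (n : ℕ) (A : AbelianVariety ℂ) (K : SchemeOver ℂ) : Prop :=
  (∃ (C : ChernCharacterBetti) (p : complexBetti A.X (2 * 2)) (H : complexBetti A.X (2 * 1))
      (v : (i : ℕ) → complexBetti A.X (2 * i)) (M : SchemeOver ℂ) (E : (A.X ⊗ M).left.Modules),
      AbelianSurfaceSheafModuli C A p H v M E ∧ IsSmoothProjective (2 * n + 4) M ∧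
        ∃ (T : AbelianVariety ℂ) (f : M ⟶ T.X) (t : ComplexPoints T.X), Nonempty (K ≅ fiberOver f t)) ∧
    IsSmoothProjective (2 * n) K ∧ Hyperkaehler.IsOfGeneralizedKummerType n K

namespace IsKummerSheafModuliSpace

variable {n : ℕ} {A : AbelianVariety ℂ} {K : SchemeOver ℂ}

/-- A Kummer moduli space lies over an abelian SURFACE. [cite: Yoshioka2001AbelianSurfaces, §0] -/
theorem dim_eq (h : IsKummerSheafModuliSpace n A K) : A.dim = 2 := by
  obtain ⟨⟨C, p, H, v, M, E, hM, -, -⟩, -, -⟩ := h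
  exact hM.dim_eq

/-- A Kummer moduli space `K_H(v)` of dimension `2n` is smooth projective of dimension `2n` (clause).
[cite: Yoshioka2001AbelianSurfaces, Thm. 0.1 and p. 2 (dim K_H(v) = ⟨v²⟩ - 2)] -/
theorem isSmoothProjective (h : IsKummerSheafModuliSpace n A K) : IsSmoothProjective (2 * n) K := h.2.1

/-- A Kummer moduli space `K_H(v)` of dimension `2n` is of `Kumⁿ`-type (clause; [Yos01] Thm. 0.2 (1) for
`H` general). [cite: Yoshioka2001AbelianSurfaces, Thm. 0.2 (1)] -/
theorem isOfGeneralizedKummerType (h : IsKummerSheafModuliSpace n A K) :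
    Hyperkaehler.IsOfGeneralizedKummerType n K := h.2.2

/-- **THE REDUCTION behind the open question: if the Kummer moduli space `K_H(v)` is dominated by the
powers of its abelian surface `A` (the cohomological shadow of "`K_H(v)` is motivated by `A`",
[Flo23] §1 / [FFZ21] Rem. 4.8 — OPEN in print), then the Hodge conjecture holds for `K_H(v)` and for all
its powers** (Arapura's record + the tree's theorem for powers of abelian surfaces).  Kernel, modulo
`Arapura2006_…`; nothing is asserted about whether the hypothesis `hdom` holds.
[cite: Floccari2023OG6Motive, §1 (arXiv p. 2: "the question remained open")] [cite: Arapura2006, Lemma 4.2] -/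
theorem hodgeConjectureFor_of_isDominatedByPowers (h : IsKummerSheafModuliSpace n A K)
    (hA42 : Arapura2006_hodgeClasses_algebraic_of_isDominatedByPowers)
    (hdom : IsDominatedByPowers (2 * n) K 2 A.X) :
    HodgeConjectureFor (2 * n) K ∧ ∀ m : ℕ, HodgeConjectureFor ((m + 1) * (2 * n)) (K.pow (m + 1)) :=
  hodgeConjectureFor_of_isDominatedByPowers_abelianSurface hA42 A h.dim_eq h.isSmoothProjective hdom

end IsKummerSheafModuliSpace

end AbelianSurface

/-! ### Bülles 2020, Thm. 0.1 — the moduli space is motivated by the surface (cohomological shadow) -/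

section Bulles

/-- **Bülles 2020, Thm. 0.1 (REFEREED; cohomological shadow, untwisted, fine moduli spaces): "Let `S` be a
complex projective K3 surface or an abelian surface […]. Assume that `M` is […] a smooth projective moduli
space of Gieseker stable […] sheaves […]. Then the Chow motive `𝔥(M)` of `M` is a direct summand of a
motive `⊕ 𝔥(S^{k_i})(n_i)` for some `1 ≤ k_i ≤ dim M`, `n_i ∈ ℤ`."**  Rendering (module docstring): the
realisation of the printed split surjection `⊕ 𝔥(S^{k_i})(n_i) ↠ 𝔥(M)` is a family of algebraic
correspondences from the powers `S^k` whose images span `H^*(M(ℂ); ℂ)`, i.e. the tree's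
`IsDominatedByPowers (dim M) M 2 S`.  Clause (i): `S` a K3 surface, `(M, 𝓔) = M_H(v)` a fine moduli space
in the sense of the tree's `K3SheafModuliUniversalFamily C S p H v M 𝓔` with `C` coherent-additive on `S`,
`p` an integral generator of `H⁴(S(ℂ); ℂ)` and `H` a polarisation class (`IsPolarizationClass 2 S H`),
`M` smooth projective of dimension `d`.  Clause (ii): `S = A` an abelian surface, `(M, 𝓔) = M_H(v)` in
the sense of `AbelianSurfaceSheafModuli C A p H v M 𝓔`, `M` smooth projective of dimension `d`.  READING
(as for every record on these carriers, `K3SheafModuli` module docstring items 1–7): `C` is the Chern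
character, `p` the point class, `H` the class of an ample divisor; at such parameters the hypotheses say
exactly "`M` is a smooth projective (fine) moduli space of Gieseker `H`-stable sheaves on `S`", which is
Bülles' hypothesis — the tree's `IsPolarizationClass` (rational, algebraic, hard Lefschetz) does not by
itself single out the ample cone, and the predicate is not claimed to describe a moduli space of stable
sheaves in the printed sense for other parameters (scope caveat, recorded; no consumer reads it there).
WEAKER than print (cohomological shadow of a Chow statement; fine moduli spaces; `α = 1`).  A THEOREM in
print, unproved in the tree. [cite: Bulles2020, Thm. 0.1 (arXiv:1806.08284 Thm. 1, p. 3; proof §1.1 p. 6)]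
[cite: Arapura2006, §1 Lemma 1.1 (the form "dominated by powers")]
[cite: Floccari2023OG6Motive, §1 ("for M_w(A,H) … confirmed by Bülles")] -/
def Bulles2020_sheafModuli_isDominatedByPowers_surface : Prop :=
  (∀ (C : ChernCharacterBetti) (S : SchemeOver ℂ) (p : complexBetti S (2 * 2)) (H : complexBetti S (2 * 1))
      (v : Surfaces.MukaiSpace S) (M : SchemeOver ℂ) (E : (S ⊗ M).left.Modules) (d : ℕ),
      C.CoherentAdditiveOn S →
      (IsIntegralClass p ∧ ∀ q : complexBetti S (2 * 2), IsIntegralClass q → ∃ m : ℤ, q = m • p) →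
      IsPolarizationClass 2 S H →
      K3SheafModuliUniversalFamily C S p H v M E → IsSmoothProjective d M → IsDominatedByPowers d M 2 S) ∧
  ∀ (C : ChernCharacterBetti) (A : AbelianVariety ℂ) (p : complexBetti A.X (2 * 2))
    (H : complexBetti A.X (2 * 1)) (v : (i : ℕ) → complexBetti A.X (2 * i)) (M : SchemeOver ℂ)
    (E : (A.X ⊗ M).left.Modules) (d : ℕ),
    AbelianSurfaceSheafModuli C A p H v M E → IsSmoothProjective d M → IsDominatedByPowers d M 2 A.X

namespace Bulles2020_sheafModuli_isDominatedByPowers_surface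

/-- Clause (ii) (abelian surfaces). [cite: Bulles2020, Thm. 0.1] -/
theorem abelianSurface (h : Bulles2020_sheafModuli_isDominatedByPowers_surface) {C : ChernCharacterBetti}
    {A : AbelianVariety ℂ} {p : complexBetti A.X (2 * 2)} {H : complexBetti A.X (2 * 1)}
    {v : (i : ℕ) → complexBetti A.X (2 * i)} {M : SchemeOver ℂ} {E : (A.X ⊗ M).left.Modules} {d : ℕ}
    (hM : AbelianSurfaceSheafModuli C A p H v M E) (hMd : IsSmoothProjective d M) :
    IsDominatedByPowers d M 2 A.X :=
  h.2 C A p H v M E d hM hMd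

/-- Clause (i) (K3 surfaces). [cite: Bulles2020, Thm. 0.1] -/
theorem k3 (h : Bulles2020_sheafModuli_isDominatedByPowers_surface) {C : ChernCharacterBetti}
    {S : SchemeOver ℂ} {p : complexBetti S (2 * 2)} {H : complexBetti S (2 * 1)} {v : Surfaces.MukaiSpace S}
    {M : SchemeOver ℂ} {E : (S ⊗ M).left.Modules} {d : ℕ} (hC : C.CoherentAdditiveOn S)
    (hp : IsIntegralClass p ∧ ∀ q : complexBetti S (2 * 2), IsIntegralClass q → ∃ m : ℤ, q = m • p)
    (hH : IsPolarizationClass 2 S H)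
    (hM : K3SheafModuliUniversalFamily C S p H v M E) (hMd : IsSmoothProjective d M) :
    IsDominatedByPowers d M 2 S :=
  h.1 C S p H v M E d hC hp hH hM hMd

/-- **The Hodge conjecture for every smooth projective fine moduli space `M_H(v)` of stable sheaves on a
complex abelian surface, and for all its powers** — Bülles' theorem (shadow) + Arapura 2006 Lemma 4.2 +
the Hodge conjecture for all powers of abelian surfaces (a THEOREM of the tree,
`hodgeConjectureFor_powSucc_of_surface`).  In print this is how [Flo23] Cor. 2 / [FFZ21] argue for the
OG6/OG10 resolutions ("By [Moonen–Zarhin], the Hodge conjecture holds for any self-product of the Abelian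
surface `A`. Then [Ara06] implies …"); for `M_H(v)` itself it is implicit in [Bül20] + [RM08].  Kernel,
modulo the two records `h`, `hA42`. [cite: Bulles2020, Thm. 0.1] [cite: Arapura2006, Lemma 4.2]
[cite: Floccari2023OG6Motive, proof of Cor. 2 (arXiv p. 6: Moonen–Zarhin + Arapura)] -/
theorem hodgeConjectureFor_abelianSurface (h : Bulles2020_sheafModuli_isDominatedByPowers_surface)
    (hA42 : Arapura2006_hodgeClasses_algebraic_of_isDominatedByPowers) {C : ChernCharacterBetti}
    {A : AbelianVariety ℂ} {p : complexBetti A.X (2 * 2)} {H : complexBetti A.X (2 * 1)}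
    {v : (i : ℕ) → complexBetti A.X (2 * i)} {M : SchemeOver ℂ} {E : (A.X ⊗ M).left.Modules} {d : ℕ}
    (hM : AbelianSurfaceSheafModuli C A p H v M E) (hMd : IsSmoothProjective d M) :
    HodgeConjectureFor d M ∧ ∀ m : ℕ, HodgeConjectureFor ((m + 1) * d) (M.pow (m + 1)) :=
  hodgeConjectureFor_of_isDominatedByPowers_abelianSurface hA42 A hM.dim_eq hMd (h.abelianSurface hM hMd)

/-- **K3 surfaces: the Hodge conjecture for all powers `Sᵏ` of the K3 surface implies the Hodge conjecture
for every smooth projective fine moduli space `M_H(v)` of stable sheaves on `S` and for all its powers**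
(Bülles + Arapura; the hypothesis `hS` is the open "Hodge conjecture for powers of a K3 surface", known
e.g. for Kummer surfaces — next theorem). Kernel, modulo the two records. [cite: Bulles2020, Thm. 0.1 and Cor. 0.2]
[cite: Arapura2006, Lemma 4.2] -/
theorem hodgeConjectureFor_K3_of_powers (h : Bulles2020_sheafModuli_isDominatedByPowers_surface)
    (hA42 : Arapura2006_hodgeClasses_algebraic_of_isDominatedByPowers) {C : ChernCharacterBetti}
    {S : SchemeOver ℂ} {p : complexBetti S (2 * 2)} {H : complexBetti S (2 * 1)} {v : Surfaces.MukaiSpace S}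
    {M : SchemeOver ℂ} {E : (S ⊗ M).left.Modules} {d : ℕ} (hC : C.CoherentAdditiveOn S)
    (hp : IsIntegralClass p ∧ ∀ q : complexBetti S (2 * 2), IsIntegralClass q → ∃ m : ℤ, q = m • p)
    (hH : IsPolarizationClass 2 S H)
    (hM : K3SheafModuliUniversalFamily C S p H v M E) (hMd : IsSmoothProjective d M)
    (hS2 : IsSmoothProjective 2 S) (hS : ∀ m : ℕ, HodgeConjectureFor ((m + 1) * 2) (S.pow (m + 1))) :
    HodgeConjectureFor d M ∧ ∀ m : ℕ, HodgeConjectureFor ((m + 1) * d) (M.pow (m + 1)) :=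
  hA42 hS2 hMd (h.k3 hC hp hH hM hMd) hS

/-- **The Kummer-surface instance, modulo Xu's record: for the Kummer surface `S = K¹(B) = Km(B)` of a
complex abelian surface `B` (which is a K3 surface — part of the hypothesis `hM`), every smooth projective
fine moduli space `M_H(v)` of stable sheaves on `S`, and each of its powers, satisfies the Hodge
conjecture** (Xu 2018 Thm. 1.3, `n = 1`: `HC(Km(B)ᵏ)` for all `k`; then Bülles + Arapura).  Kernel, modulo
the three records. [cite: Bulles2020, Thm. 0.1 and Cor. 0.2] [cite: Xu2018Kummer, Thm. 1.3 (n = 1)]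
[cite: Arapura2006, Lemma 4.2] -/
theorem hodgeConjectureFor_kummerK3 (h : Bulles2020_sheafModuli_isDominatedByPowers_surface)
    (hA42 : Arapura2006_hodgeClasses_algebraic_of_isDominatedByPowers)
    (hXu : Hyperkaehler.Xu2018_hodgeClasses_algebraic_generalizedKummerVariety) {B : AbelianVariety ℂ}
    (hB : B.dim = 2) {C : ChernCharacterBetti} {S : SchemeOver ℂ} {p : complexBetti S (2 * 2)}
    {H : complexBetti S (2 * 1)} {v : Surfaces.MukaiSpace S} {M : SchemeOver ℂ} {E : (S ⊗ M).left.Modules}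
    {d : ℕ} (hKm : Hyperkaehler.IsGeneralizedKummerVarietyOf 1 B S) (hS2 : IsSmoothProjective (2 * 1) S)
    (hC : C.CoherentAdditiveOn S)
    (hp : IsIntegralClass p ∧ ∀ q : complexBetti S (2 * 2), IsIntegralClass q → ∃ m : ℤ, q = m • p)
    (hH : IsPolarizationClass 2 S H)
    (hM : K3SheafModuliUniversalFamily C S p H v M E) (hMd : IsSmoothProjective d M) :
    HodgeConjectureFor d M ∧ ∀ m : ℕ, HodgeConjectureFor ((m + 1) * d) (M.pow (m + 1)) :=
  h.hodgeConjectureFor_K3_of_powers hA42 hC hp hH hM hMd hS2 fun m ↦ by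
    simpa using (hXu 1 B hB le_rfl hKm hS2).2 m

end Bulles2020_sheafModuli_isDominatedByPowers_surface

end Bulles

/-! ### The settled low-dimensional cases of the open question's consequence (`n = 2, 3`), by name -/

section LowDimension

namespace IsKummerSheafModuliSpace

variable {n : ℕ} {A : AbelianVariety ℂ} {K : SchemeOver ℂ}

/-- **`n = 2, 3`: the Hodge conjecture for the Kummer moduli spaces `K_H(v)` of dimension `4` and `6`
AND for all their powers is a THEOREM modulo named records** — because every `K_H(v)` is a smooth
projective `Kumⁿ`-type variety and Floccari–Fu 2026 Thm. K (ii) / Cor. 13.4 (PREPRINT; tree record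
`Hyperkaehler.FloccariFu2026_kum2Kum3Type_isDominatedByPowers_discOneWeilFourfold` with Floccari–Fu JMPA 2026
and Arapura 2006) settle all powers of every `Kum²`/`Kum³`-type variety.  The intermediate rung
"HC for all Kummer moduli spaces" is therefore OPEN exactly for `n ≥ 4`.  Kernel, by name.
[cite: FloccariFu2026HyperKummer, Thm. K (ii) = Thm. 13.2 and Cor. 13.4 (PREPRINT)]
[cite: Yoshioka2001AbelianSurfaces, Thm. 0.2 (1) (K_H(v) is of Kummer type)] -/
theorem hodgeConjectureFor_powers_of_two_or_three (hK : IsKummerSheafModuliSpace n A K)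
    (h : Hyperkaehler.FloccariFu2026_kum2Kum3Type_isDominatedByPowers_discOneWeilFourfold)
    (hFF : FloccariFu2026_hodgeClasses_algebraic_powers_discOneWeilFourfold)
    (h42 : Arapura2006_hodgeClasses_algebraic_of_isDominatedByPowers) (hn : n = 2 ∨ n = 3) :
    HodgeConjectureFor (2 * n) K ∧ ∀ m : ℕ, HodgeConjectureFor ((m + 1) * (2 * n)) (K.pow (m + 1)) :=
  h.hodgeConjectureFor_powers hFF h42 hn hK.isSmoothProjective hK.isOfGeneralizedKummerType

/-- **`n = 2`, single variety, REFEREED: every `4`-dimensional Kummer moduli space `K_H(v)` satisfies the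
Hodge conjecture**, by Floccari–Varesco, Math. Ann. 2025, Cor. 1.2 (tree record
`Hyperkaehler.FloccariVaresco2024_hodgeClasses_algebraic_kum2Type`: every projective `Kum²`-type fourfold).
[cite: FloccariVaresco2024, Cor. 1.2] [cite: Yoshioka2001AbelianSurfaces, Thm. 0.2 (1)] -/
theorem hodgeConjectureFor_of_two (hK : IsKummerSheafModuliSpace 2 A K)
    (h : Hyperkaehler.FloccariVaresco2024_hodgeClasses_algebraic_kum2Type) : HodgeConjectureFor 4 K :=
  h hK.isSmoothProjective hK.isOfGeneralizedKummerType

/-- **`n = 3`, single variety, PREPRINT: every `6`-dimensional Kummer moduli space `K_H(v)` satisfies the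
Hodge conjecture**, by Floccari arXiv:2308.02267 Thm. 1.1 (tree record
`Hyperkaehler.Floccari2023_hodgeClasses_algebraic_kum3Type`: every projective `Kum³`-type sixfold; no
journal version as of 2026-08). [cite: Floccari2023, Thm. 1.1 (PREPRINT)] [cite: Yoshioka2001AbelianSurfaces, Thm. 0.2 (1)] -/
theorem hodgeConjectureFor_of_three (hK : IsKummerSheafModuliSpace 3 A K)
    (h : Hyperkaehler.Floccari2023_hodgeClasses_algebraic_kum3Type) : HodgeConjectureFor 6 K :=
  h hK.isSmoothProjective hK.isOfGeneralizedKummerType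

end IsKummerSheafModuliSpace

end LowDimension

/-! ### Birational models of Kummer moduli spaces -/

section Birational

namespace IsKummerSheafModuliSpace

variable {n : ℕ} {A : AbelianVariety ℂ} {K X : SchemeOver ℂ}

/-- **The Hodge conjecture passes from a Kummer moduli space `K_H(v)` to EVERY projective irreducible
symplectic variety birational to it** (Rieß 2014 / Huybrechts: birational projective irreducible
symplectic varieties have an algebraic graded-ring isomorphism of cohomology with algebraic inverse —
tree record `Hyperkaehler.Riess2014_birational_cohomologyRingIso_algebraic` with its PROVED
`….hodgeConjectureFor_iff`; `K_H(v)` itself is irreducible symplectic by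
`Hyperkaehler.Beauville1983_irreducibleSymplectic_of_kummerType`, being smooth projective of `Kumⁿ`-type).
So the intermediate rung "HC for the Kummer moduli spaces" (summit side: `HC_KummerSheafModuliSpace`)
already covers their birational models — in print: the Albanese fibres `K_τ(v)` of moduli spaces of
BRIDGELAND stable objects on abelian surfaces (of `Kumⁿ`-type: Yoshioka, *Bridgeland's stability and the
positive cone of the moduli spaces of stable objects on an abelian surface*, arXiv:1206.4838 — [Yos12] of
Mongardi–Wandel, §1 Rem. 1.31; that such a `K_τ(v)` is BIRATIONAL to a Gieseker Kummer moduli space on `A`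
or on the dual surface `Â` is the Fourier–Mukai ∕ wall-crossing analysis of Minamide–Yanagida–Yoshioka —
NOT read at source here, referee F-5) and, for `n + 1` a prime power, every "numerical moduli space" of
`Kumⁿ`-type (Mongardi–Wandel, J. LMS 92 (2015) Prop. 2.4 [corpus:paper:arxiv-1405.5706 p0009:L22–L27];
their Conj. 2.5: all `n`) — none of which has a carrier in the tree (recorded, not typed).  Kernel, modulo the three records and an
orientation family with Poincaré duality. [cite: Riess2014ChowBirational, Thm. 3.2 and Lemma 3.5]
[cite: Beauville1983, §7 Thm. 4 and §8 Prop. 9] [cite: Yoshioka2001AbelianSurfaces, Thm. 0.2 (1)] -/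
theorem hodgeConjectureFor_of_areBirational (hK : IsKummerSheafModuliSpace n A K)
    (hB : Hyperkaehler.Beauville1983_irreducibleSymplectic_of_kummerType)
    (hR : Hyperkaehler.Riess2014_birational_cohomologyRingIso_algebraic)
    (hcup : Voisin2003_cupProduct_algebraicClasses) {μ : OrientationFamily} (hμ : μ.HasPoincareDuality)
    (hn : 1 ≤ n) (hX : Hyperkaehler.IsProjectiveIrreducibleSymplectic (2 * n) X)
    (hb : Hyperkaehler.AreBirational X K) (hHC : HodgeConjectureFor (2 * n) K) :
    HodgeConjectureFor (2 * n) X :=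
  (hR.hodgeConjectureFor_iff hcup hμ hX (hB n hn hK.isSmoothProjective hK.isOfGeneralizedKummerType) hb).2
    hHC

/-- **`n = 2`: every projective irreducible symplectic fourfold birational to a `4`-dimensional Kummer
moduli space satisfies the Hodge conjecture** (previous theorem + Floccari–Varesco Cor. 1.2 record). Of
course such an `X` is itself of `Kum²`-type (birational ⇒ deformation equivalent, Huybrechts 1999
Thm. 4.6), so this is also `FloccariVaresco2024_hodgeClasses_algebraic_kum2Type` directly; recorded as the
pattern the rung's birational closure follows. [cite: FloccariVaresco2024, Cor. 1.2] [cite: Riess2014ChowBirational, Thm. 3.2] -/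
theorem hodgeConjectureFor_of_areBirational_of_two (hK : IsKummerSheafModuliSpace 2 A K)
    (hFV : Hyperkaehler.FloccariVaresco2024_hodgeClasses_algebraic_kum2Type)
    (hB : Hyperkaehler.Beauville1983_irreducibleSymplectic_of_kummerType)
    (hR : Hyperkaehler.Riess2014_birational_cohomologyRingIso_algebraic)
    (hcup : Voisin2003_cupProduct_algebraicClasses) {μ : OrientationFamily} (hμ : μ.HasPoincareDuality)
    (hX : Hyperkaehler.IsProjectiveIrreducibleSymplectic (2 * 2) X) (hb : Hyperkaehler.AreBirational X K) :
    HodgeConjectureFor (2 * 2) X :=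
  hK.hodgeConjectureFor_of_areBirational hB hR hcup hμ (by norm_num) hX hb (hK.hodgeConjectureFor_of_two hFV)

end IsKummerSheafModuliSpace

end Birational

/-! ## Yoshioka 2001, Thm. 0.2 (2) and Prop. 4.20 — `H²` and `H³` of a Kummer moduli space come from the abelian surface through algebraic correspondences (one NAMED FACT, cohomological shadow; kernel)

What the record below gives the tree, by name: (i) in degrees `2` and `3` the summit-side question
"`K_H(v)` is cohomologically dominated by the powers of `A`" (`KummerSheafModuliSpace_dominatedByAbelianSurface`,
Arapura's Lemma 1.1 form, power `e = 1`) is answered IN PRINT by Yoshioka 2001 — the unsettled range of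
that question is `4 ≤ k ≤ 4n - 4`; (ii) for the O'Grady 2021 ∕ Markman 2023 "abelian fourfold of Weil
type `J³(X)` attached to a `Kumⁿ`-type `X`" (tree records
`Hyperkaehler.Markman2023_thirdCohomology_kummerType_discOneWeilFourfold`,
`HodgeTheory.OGradyMarkman_discOneWeilFourfold_isThirdJacobian_kummerType`): on the Kummer-moduli loci
that fourfold is `J₂(K_H(v)) ≅ X̂ × X = Â × A` (isogenous to `A × A`) by this 2001 theorem, so there the
per-variety Hodge statement for all powers of `J³(X)` is the tree's theorem for powers of abelian surfaces
(`HodgeTheory.hodgeConjectureFor_powSucc_of_surface`) up to isogeny; (iii) `b₃(K_H(v)) = 4 + 4 = 8`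
recomputed from the record agrees with Göttsche's value for the deformation type
(`….finrank_complexBetti_three` below vs. `Hyperkaehler.Markman2023_….finrank_complexBetti_three`). -/

section LowDegrees

/-- **Yoshioka 2001, Thm. 0.2 (2) (the period of `K_H(v)`) and Prop. 4.20 (its intermediate Jacobian)
— REFEREED; cohomological shadow with complex coefficients: the second and the third cohomology of a
Kummer moduli space of sheaves `K_H(v)` are images of the cohomology of the abelian surface under
algebraic correspondences built from the Chern character of the universal family.**  Printed ([Yos01];
locators in the arXiv:math/0009001 text, whose §5 is the journal's §4 and whose Thm. 1.2 is the journal's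
Thm. 0.2 — the within-section counters below are the arXiv text's, shifted `5.k ↦ 4.k` for the journal by
the same rule, not independently checked against the printed journal):
* Thm. 0.2 (2) [p0002:L108–L135]: "Let `X` be an abelian surface. Let `v ∈ H^{ev}(X, ℤ)` be a primitive
  Mukai vector such that `v > 0`, `c₁(v) ∈ NS(X)` and `⟨v²⟩ ≥ 6`. […] (2) Let `B_{K_H(v)}` be Beauville's
  bilinear form on `H²(K_H(v), ℤ)`. Then `θ_v : (v^⊥, ⟨ , ⟩) → (H²(K_H(v), ℤ), B_{K_H(v)})` is an
  isometry of Hodge structures, where `θ_v` is the composition of Mukai homomorphism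
  `v^⊥ → H²(M_H(v), ℤ)` and the restriction map `H²(M_H(v), ℤ) → H²(K_H(v), ℤ)`", the map being
  (Def. 4.2 = arXiv Def. 5.2, p0014:L8–L16) "`θ_v(x) = -(1/ρ)[p_{K_H(v)*}(ch(ℰ|_{K_H(v) × X}) x^∨)]_1`";
* Prop. 4.20 (= arXiv Prop. 5.20, §5.5 "Intermediate jacobian", p0021:L95–L121): "We define a
  homomorphism `j_v : H^{odd}(X, ℤ) → H³(K_H(v), ℤ)_f` by
  `j_v(x) := -(1/ρ)[p_{K_H(v)*}(ch(ℰ|_{K_H(v) × X}) x)]_{3/2}` […] Let `v` be a primitive Mukai vector such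
  that `v > 0`, `c₁(v) ∈ NS(X)` and `⟨v²⟩ ≥ 6`. Then `j_v : H¹(X, ℤ) ⊕ H³(X, ℤ) → H³(K_H(v), ℤ)_f` is an
  isomorphism preserving Hodge structures. In particular, `J₂(K_H(v)) ≅ X̂ × X`."
Standing hypotheses of that section for both statements (Prop. 4.12 = arXiv Prop. 5.12, p0017:L115–L135,
through which the general case is reduced to Beauville's `Kₙ(A)`): `H` an ample divisor with
`M̄_H(v) = M_H(v)` and `rk v > 0`; `ℰ` a quasi-universal family of similitude `ρ` (`ρ = 1` for a universal
family).  The étale splitting behind it ("after an étale base-change `M_v(A,H)` splits as the product of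
`K_v(A,H)` with `A × Â`", Floccari 2023 §2 [corpus:paper:arxiv-2203.16257 p0004:L10]; [Yos01] §4.1:
`Φ : K_H(v) × X × X̂ → M_H(v)`, `(E, x, y) ↦ T_x^*E ⊗ 𝒫_y`, p0013:L124–L127 and p0014:L5–L7) is not
rendered.

Rendering, for `K` with `IsKummerSheafModuliSpace n A K` and `2 ≤ n` (classically `K = K_H(v)`, `v`
primitive and torsion-free of positive rank, `⟨v²⟩ = 2n + 2 ≥ 6`, `M_H(v) = M̄_H(v)` fine — module
docstring; exactly the printed hypotheses): the maps `x ↦ ±[p_{K*}(ch_j(ℰ|_{K × A}) ∪ p_A^* x)]` are the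
actions of the ALGEBRAIC classes `ch_j(ℰ|_{K × A}) ∈ H^{2j}((K × A)(ℂ); ℂ)` as correspondences from `A`
to `K` (`HodgeTheory.IsAlgebraicCorrespondence (2 * n) 2 K A.X`; the scalar `-1/ρ` and the signs of the
Mukai dual `x^∨` are harmless, the algebraic classes forming a `ℂ`-subspace and the action being linear in
the class), so:
(H²) there are algebraic correspondences `γ₀ : H⁰(A) → H²(K)`, `γ₂ : H²(A) → H²(K)`, `γ₄ : H⁴(A) → H²(K)`
(the degree-`2` components of the actions of `ch₃`, `ch₂`, `ch₁`) whose images SPAN `H²(K(ℂ); ℂ)`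
(`θ_v ⊗ ℂ` is an injective map from `v^⊥ ⊗ ℂ`, of dimension `7 = b₂(K_H(v))`, hence onto);
(H³) there are algebraic correspondences `γ₁ : H¹(A) → H³(K)`, `γ₃ : H³(A) → H³(K)` (from `ch₃`, `ch₂`)
with `γ₁ ⊕ γ₃ : H¹(A(ℂ); ℂ) ⊕ H³(A(ℂ); ℂ) → H³(K(ℂ); ℂ)` BIJECTIVE (`j_v ⊗ ℂ`).
WEAKER than print: complex coefficients (the integral lattices, the torsion-free quotient, the isometry
with the Beauville form and the Hodge-structure clauses are dropped — an algebraic correspondence is a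
morphism of Hodge structures classically, not recorded), the explicit formulas are replaced by "induced by
SOME algebraic cycle on `K × A`", and `J₂(K_H(v)) ≅ X̂ × X` is not rendered (no intermediate-Jacobian
carrier is used).  What the record gives the tree is spelled out in the section docstring above and in
the kernel below.  A THEOREM in print (Math. Ann. 321 (2001) 817–884; status: proved), unproved in the
tree; one named fact (D-0014).
[cite: Yoshioka2001AbelianSurfaces, Thm. 0.2 (2) with Def. 4.2 (θ_v) and Prop. 4.20 (j_v) under the hypotheses of Prop. 4.12 (arXiv:math/0009001 text: Thm. 1.2 (2), Def. 5.2, Prop. 5.20 of §5.5 "Intermediate jacobian", Prop. 5.12)] -/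
def Yoshioka2001_secondThirdCohomology_kummerSheafModuliSpace : Prop :=
  ∀ (n : ℕ), 2 ≤ n → ∀ (A : AbelianVariety ℂ) ⦃K : SchemeOver ℂ⦄, IsKummerSheafModuliSpace n A K →
    (∃ (γ₀ : complexBetti A.X 0 →ₗ[ℂ] complexBetti K 2) (γ₂ : complexBetti A.X 2 →ₗ[ℂ] complexBetti K 2)
        (γ₄ : complexBetti A.X 4 →ₗ[ℂ] complexBetti K 2),
        IsAlgebraicCorrespondence (2 * n) 2 K A.X γ₀ ∧ IsAlgebraicCorrespondence (2 * n) 2 K A.X γ₂ ∧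
          IsAlgebraicCorrespondence (2 * n) 2 K A.X γ₄ ∧
            LinearMap.range γ₀ ⊔ LinearMap.range γ₂ ⊔ LinearMap.range γ₄ = ⊤) ∧
      ∃ (γ₁ : complexBetti A.X 1 →ₗ[ℂ] complexBetti K 3) (γ₃ : complexBetti A.X 3 →ₗ[ℂ] complexBetti K 3),
        IsAlgebraicCorrespondence (2 * n) 2 K A.X γ₁ ∧ IsAlgebraicCorrespondence (2 * n) 2 K A.X γ₃ ∧
          Function.Bijective (γ₁.coprod γ₃)

namespace Yoshioka2001_secondThirdCohomology_kummerSheafModuliSpace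

variable {n : ℕ} {A : AbelianVariety ℂ} {K : SchemeOver ℂ}

/-- Clause (H²): `H²(K_H(v)(ℂ); ℂ)` is spanned by the images of three algebraic correspondences from the
abelian surface (Thm. 0.2 (2), shadow). [cite: Yoshioka2001AbelianSurfaces, Thm. 0.2 (2)] -/
theorem two (h : Yoshioka2001_secondThirdCohomology_kummerSheafModuliSpace) (hn : 2 ≤ n)
    (hK : IsKummerSheafModuliSpace n A K) :
    ∃ (γ₀ : complexBetti A.X 0 →ₗ[ℂ] complexBetti K 2) (γ₂ : complexBetti A.X 2 →ₗ[ℂ] complexBetti K 2)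
      (γ₄ : complexBetti A.X 4 →ₗ[ℂ] complexBetti K 2),
      IsAlgebraicCorrespondence (2 * n) 2 K A.X γ₀ ∧ IsAlgebraicCorrespondence (2 * n) 2 K A.X γ₂ ∧
        IsAlgebraicCorrespondence (2 * n) 2 K A.X γ₄ ∧
          LinearMap.range γ₀ ⊔ LinearMap.range γ₂ ⊔ LinearMap.range γ₄ = ⊤ :=
  (h n hn A hK).1

/-- Clause (H³): `H¹(A) ⊕ H³(A) ≅ H³(K_H(v))` through two algebraic correspondences (Prop. 4.20, shadow).
[cite: Yoshioka2001AbelianSurfaces, Prop. 4.20 (arXiv text Prop. 5.20)] -/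
theorem three (h : Yoshioka2001_secondThirdCohomology_kummerSheafModuliSpace) (hn : 2 ≤ n)
    (hK : IsKummerSheafModuliSpace n A K) :
    ∃ (γ₁ : complexBetti A.X 1 →ₗ[ℂ] complexBetti K 3) (γ₃ : complexBetti A.X 3 →ₗ[ℂ] complexBetti K 3),
      IsAlgebraicCorrespondence (2 * n) 2 K A.X γ₁ ∧ IsAlgebraicCorrespondence (2 * n) 2 K A.X γ₃ ∧
        Function.Bijective (γ₁.coprod γ₃) :=
  (h n hn A hK).2

/-- `H³(K_H(v)(ℂ); ℂ)` is spanned by the images of the two algebraic correspondences from `A` (the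
degree-`3` line of "`K_H(v)` is dominated by `A`", power `e = 1`). Kernel.
[cite: Yoshioka2001AbelianSurfaces, Prop. 4.20 (arXiv text Prop. 5.20)] [cite: Arapura2006, §1 Lemma 1.1 (shape)] -/
theorem range_sup_range_eq_top_three (h : Yoshioka2001_secondThirdCohomology_kummerSheafModuliSpace)
    (hn : 2 ≤ n) (hK : IsKummerSheafModuliSpace n A K) :
    ∃ (γ₁ : complexBetti A.X 1 →ₗ[ℂ] complexBetti K 3) (γ₃ : complexBetti A.X 3 →ₗ[ℂ] complexBetti K 3),
      IsAlgebraicCorrespondence (2 * n) 2 K A.X γ₁ ∧ IsAlgebraicCorrespondence (2 * n) 2 K A.X γ₃ ∧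
        LinearMap.range γ₁ ⊔ LinearMap.range γ₃ = ⊤ := by
  obtain ⟨γ₁, γ₃, h₁, h₃, hbij⟩ := (h n hn A hK).2
  exact ⟨γ₁, γ₃, h₁, h₃, by rw [← LinearMap.range_coprod, LinearMap.range_eq_top]; exact hbij.2⟩

/-- **`b₃(K_H(v)) = b₁(A) + b₃(A) = 4 + 4 = 8` from Yoshioka's record** (with the tree's theorem
`b_d(A) = (2 dim A choose d)`, `Motives.abelianVarietyCohomologyExteriorH1_holds`) — Göttsche's value for
`Kumⁿ`-type varieties, which the tree derives for the whole deformation type from the O'Grady–Markman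
record (`Hyperkaehler.Markman2023_thirdCohomology_kummerType_discOneWeilFourfold.finrank_complexBetti_three`);
the two records agree on the Kummer moduli spaces. Kernel, modulo the record `h`.
[cite: Yoshioka2001AbelianSurfaces, Prop. 4.20 and its proof ("Göttsche proved that b₃(K_H(v)) = 8", arXiv p0021:L131)] -/
theorem finrank_complexBetti_three (h : Yoshioka2001_secondThirdCohomology_kummerSheafModuliSpace)
    (hn : 2 ≤ n) (hK : IsKummerSheafModuliSpace n A K) :
    Module.finrank ℂ (complexBetti K 3) = 8 := by
  obtain ⟨γ₁, γ₃, -, -, hbij⟩ := (h n hn A hK).2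
  haveI := Motives.abelianVarietyCohomologyExteriorH1_holds.finite A 1
  haveI := Motives.abelianVarietyCohomologyExteriorH1_holds.finite A 3
  rw [← (LinearEquiv.ofBijective (γ₁.coprod γ₃) hbij).finrank_eq, Module.finrank_prod,
    Motives.abelianVarietyCohomologyExteriorH1_holds.finrank_eq A 1,
    Motives.abelianVarietyCohomologyExteriorH1_holds.finrank_eq A 3, hK.dim_eq]
  decide

/-- **`b₂(K_H(v)) ≤ b₀(A) + b₂(A) + b₄(A) = 1 + 6 + 1 = 8` from clause (H²)** (the printed value is
`7 = rk v^⊥`; the shadow keeps only "spanned by the three images"). Kernel, modulo the record `h`.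
[cite: Yoshioka2001AbelianSurfaces, Thm. 0.2 (2)] -/
theorem finrank_complexBetti_two_le (h : Yoshioka2001_secondThirdCohomology_kummerSheafModuliSpace)
    (hn : 2 ≤ n) (hK : IsKummerSheafModuliSpace n A K) :
    Module.finrank ℂ (complexBetti K 2) ≤ 8 := by
  obtain ⟨γ₀, γ₂, γ₄, -, -, -, htop⟩ := (h n hn A hK).1
  haveI := Motives.abelianVarietyCohomologyExteriorH1_holds.finite A 0
  haveI := Motives.abelianVarietyCohomologyExteriorH1_holds.finite A 2
  haveI := Motives.abelianVarietyCohomologyExteriorH1_holds.finite A 4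
  have h0 := Motives.abelianVarietyCohomologyExteriorH1_holds.finrank_eq A 0
  have h2 := Motives.abelianVarietyCohomologyExteriorH1_holds.finrank_eq A 2
  have h4 := Motives.abelianVarietyCohomologyExteriorH1_holds.finrank_eq A 4
  rw [hK.dim_eq] at h0 h2 h4
  have e0 : Module.finrank ℂ (LinearMap.range γ₀) ≤ 1 :=
    (LinearMap.finrank_range_le γ₀).trans (by rw [h0]; decide)
  have e2 : Module.finrank ℂ (LinearMap.range γ₂) ≤ 6 :=
    (LinearMap.finrank_range_le γ₂).trans (by rw [h2]; decide)
  have e4 : Module.finrank ℂ (LinearMap.range γ₄) ≤ 1 :=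
    (LinearMap.finrank_range_le γ₄).trans (by rw [h4]; decide)
  rw [← finrank_top ℂ (complexBetti K 2), ← htop]
  calc Module.finrank ℂ ↥(LinearMap.range γ₀ ⊔ LinearMap.range γ₂ ⊔ LinearMap.range γ₄)
      ≤ Module.finrank ℂ ↥(LinearMap.range γ₀ ⊔ LinearMap.range γ₂) +
          Module.finrank ℂ ↥(LinearMap.range γ₄) := Submodule.finrank_add_le_finrank_add_finrank _ _
    _ ≤ (Module.finrank ℂ ↥(LinearMap.range γ₀) + Module.finrank ℂ ↥(LinearMap.range γ₂)) +
          Module.finrank ℂ ↥(LinearMap.range γ₄) := by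
        gcongr; exact Submodule.finrank_add_le_finrank_add_finrank _ _
    _ ≤ (1 + 6) + 1 := by gcongr
    _ = 8 := rfl

end Yoshioka2001_secondThirdCohomology_kummerSheafModuliSpace

end LowDegrees

/-! ## The Kummer-birational locus: a Kummer moduli space birational to a generalized Kummer variety `Kⁿ(B)` satisfies the Hodge conjecture, every `n` (kernel)

The summit-side question `HC_KummerSheafModuliSpace` (all `K_H(v)`, all `n`) is settled IN PRINT on the
locus of Kummer moduli spaces BIRATIONAL to Beauville's generalized Kummer variety `Kⁿ(B)` of some
abelian surface `B`: `HC(Kⁿ(B))` is Xu 2018 Thm. 1.3 (record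
`Hyperkaehler.Xu2018_hodgeClasses_algebraic_generalizedKummerVariety`), and the Hodge conjecture is a
birational invariant among projective irreducible symplectic varieties (Rieß 2014, record
`Hyperkaehler.Riess2014_birational_cohomologyRingIso_algebraic` with its PROVED `….hodgeConjectureFor_iff`).
That locus is non-empty and explicit in [Yos01]: (i) rank one — "We set `v := 1 - nω`. Then `M_H(v)`
is naturally identified with `X^{[n]} × X̂` […] Hence `K_H(v)` is identified with `K_{n-1}`" (§4.3.1 =
arXiv §5.3.1, p0016:L25–L29; a general rank-one `v = (1 - nω) exp(ξ)` is reduced to this one by the twist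
(eq:isomT), arXiv Prop. 5.11 "(Beauville)" p0017:L88–L103 — journal numbers by the rule `5.k ↦ 4.k` of
the `LowDegrees` section, not independently checked against the printed journal); (ii) `NS(X) = ℤH`,
`v = r + H + ω`: the Fourier–Mukai functor `𝒢_𝒫` induces an ISOMORPHISM `M_H(v) → M_Ĥ(w)`,
`w = 1 + Ĥ + r ω̂`, commuting with the Albanese maps, "hence under `𝒢_𝒫`, we can identify `K_H(v)` with
`K_Ĥ(w)`" (proof of Thms. 0.1–0.2, arXiv p0018:L33–L55) — a rank-one, i.e. generalized Kummer, fibre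
on the dual surface; (iii) the birational Fourier–Mukai identifications of Yoshioka's Appendix
(Prop. "modification") and of [Y:3] — none rendered here (no Mukai-lattice ∕ Fourier–Mukai carrier is
needed for the kernel statement, which takes the birational map as a hypothesis).  So the OPEN part of
the rung is the complement of the Kummer-birational locus (together with `n ≥ 4` off the loci of
§LowDimension).  Nothing is asserted about which `K_H(v)` lie on the locus. -/

section KummerBirational

namespace IsKummerSheafModuliSpace

variable {n : ℕ} {A B : AbelianVariety ℂ} {K Y : SchemeOver ℂ}

/-- **Every Kummer moduli space `K_H(v)` (of dimension `2n`, `n ≥ 1`) birational to a generalized Kummer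
variety `Kⁿ(B)` of a complex abelian surface `B` satisfies the Hodge conjecture** — Xu 2018 Thm. 1.3
(`HC(Kⁿ(B))`) transported along the birational map by Rieß 2014 ∕ Huybrechts (algebraic graded-ring
isomorphism of cohomology with algebraic inverse ⇒ `HC(K) ⟺ HC(Kⁿ(B))`,
`Riess2014_birational_cohomologyRingIso_algebraic.hodgeConjectureFor_iff`), both sides being projective
irreducible symplectic by Beauville 1983 (`K` is smooth projective of `Kumⁿ`-type; `Kⁿ(B)` by
`Beauville1983_irreducibleSymplectic_of_kummerType.generalizedKummer`).  Kernel, modulo the four records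
and an orientation family with Poincaré duality; the printed instances of the hypothesis `hb` (rank one;
`NS = ℤH`, `v = r + H + ω` via `𝒢_𝒫`) are in the section docstring.  Compare
`hodgeConjectureFor_of_areBirational` (the opposite direction: from `K_H(v)` to its birational models).
[cite: Xu2018Kummer, Thm. 1.3] [cite: Riess2014ChowBirational, Thm. 3.2 and Lemma 3.5]
[cite: Beauville1983, §7 Thm. 4 and §8 Prop. 9]
[cite: Yoshioka2001AbelianSurfaces, §4.3.1 (arXiv:math/0009001 §5.3.1 p. 16: "K_H(v) is identified with K_{n-1}", Prop. 5.11) and proof of Thms. 0.1–0.2 (arXiv p. 18: K_H(v) ≅ K_Ĥ(w), w of rank one)] -/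
theorem hodgeConjectureFor_of_areBirational_generalizedKummer (hK : IsKummerSheafModuliSpace n A K)
    (hXu : Hyperkaehler.Xu2018_hodgeClasses_algebraic_generalizedKummerVariety)
    (hB : Hyperkaehler.Beauville1983_irreducibleSymplectic_of_kummerType)
    (hR : Hyperkaehler.Riess2014_birational_cohomologyRingIso_algebraic)
    (hcup : Voisin2003_cupProduct_algebraicClasses) {μ : OrientationFamily} (hμ : μ.HasPoincareDuality)
    (hn : 1 ≤ n) (hBd : B.dim = 2) (hY : Hyperkaehler.IsGeneralizedKummerVarietyOf n B Y)
    (hYs : IsSmoothProjective (2 * n) Y) (hb : Hyperkaehler.AreBirational K Y) :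
    HodgeConjectureFor (2 * n) K :=
  (hR.hodgeConjectureFor_iff hcup hμ (hB n hn hK.isSmoothProjective hK.isOfGeneralizedKummerType)
      (hB.generalizedKummer hn hBd hY hYs) hb).2 (hXu.hodgeConjectureFor hBd hn hY hYs)

/-- **Same, over the SAME abelian surface and with the birational map given in either direction**
(`AreBirational` is symmetric): `K_H(v)` on `A` birational to `Kⁿ(A)` ⇒ `HC(K_H(v))` — the shape of
Yoshioka's rank-one identification (section docstring (i)). Kernel.
[cite: Xu2018Kummer, Thm. 1.3] [cite: Riess2014ChowBirational, Thm. 3.2]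
[cite: Yoshioka2001AbelianSurfaces, §4.3.1 (arXiv §5.3.1 p. 16 and Prop. 5.11: rank one)] -/
theorem hodgeConjectureFor_of_areBirational_generalizedKummer' (hK : IsKummerSheafModuliSpace n A K)
    (hXu : Hyperkaehler.Xu2018_hodgeClasses_algebraic_generalizedKummerVariety)
    (hB : Hyperkaehler.Beauville1983_irreducibleSymplectic_of_kummerType)
    (hR : Hyperkaehler.Riess2014_birational_cohomologyRingIso_algebraic)
    (hcup : Voisin2003_cupProduct_algebraicClasses) {μ : OrientationFamily} (hμ : μ.HasPoincareDuality)
    (hn : 1 ≤ n) (hY : Hyperkaehler.IsGeneralizedKummerVarietyOf n A Y)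
    (hYs : IsSmoothProjective (2 * n) Y) (hb : Hyperkaehler.AreBirational Y K) :
    HodgeConjectureFor (2 * n) K :=
  hK.hodgeConjectureFor_of_areBirational_generalizedKummer hXu hB hR hcup hμ hn hK.dim_eq hY hYs hb.symm

/-- **… and then every projective irreducible symplectic variety birational to such a `K_H(v)` satisfies
the Hodge conjecture too** (chaining with `hodgeConjectureFor_of_areBirational`): the rung's birational
closure on the Kummer-birational locus, by name. Kernel.
[cite: Xu2018Kummer, Thm. 1.3] [cite: Riess2014ChowBirational, Thm. 3.2 and Lemma 3.5] -/
theorem hodgeConjectureFor_of_areBirational_of_areBirational_generalizedKummer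
    (hK : IsKummerSheafModuliSpace n A K) {X : SchemeOver ℂ}
    (hXu : Hyperkaehler.Xu2018_hodgeClasses_algebraic_generalizedKummerVariety)
    (hB : Hyperkaehler.Beauville1983_irreducibleSymplectic_of_kummerType)
    (hR : Hyperkaehler.Riess2014_birational_cohomologyRingIso_algebraic)
    (hcup : Voisin2003_cupProduct_algebraicClasses) {μ : OrientationFamily} (hμ : μ.HasPoincareDuality)
    (hn : 1 ≤ n) (hBd : B.dim = 2) (hY : Hyperkaehler.IsGeneralizedKummerVarietyOf n B Y)
    (hYs : IsSmoothProjective (2 * n) Y) (hb : Hyperkaehler.AreBirational K Y)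
    (hX : Hyperkaehler.IsProjectiveIrreducibleSymplectic (2 * n) X) (hbX : Hyperkaehler.AreBirational X K) :
    HodgeConjectureFor (2 * n) X :=
  hK.hodgeConjectureFor_of_areBirational hB hR hcup hμ hn hX hbX
    (hK.hodgeConjectureFor_of_areBirational_generalizedKummer hXu hB hR hcup hμ hn hBd hY hYs hb)

end IsKummerSheafModuliSpace

end KummerBirational

end Literature.AlgebraicGeometry.ModuliOfSheaves

end
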